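import Mathlib
import Summits.CriticalPhenomena.Ising3DConformalLimit.Theorems.PrecisionLaplacianInverseMFerromagnetSpSubdivide
import HarnessLib

/-!
# Crux `PrecisionLaplacian.InverseMFerromagnet` (stmt-CriticalPhenomena-4798), line `Sketch` —
# stub `helper_subdivide_entry_invariant` (theta-law anchor Θ2)

THEOREM-ONLY file (no definitions).  Subdividing the bond `i₀ = {a, b}` through the new site
`ℓ = Fin.last n` (old sites embedded by `Fin.castSucc`; `C' i₀.castSucc = {a', ℓ}` with coupling
`u = K' i₀.castSucc`, `C' (Fin.last m) = {ℓ, b'}` with coupling `w = K' (Fin.last m)`) changes NO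
entry of the precision matrix `Σ⁻¹` between old sites `p ≠ q` with `{p, q} ≠ {a, b}`, provided the
old structure carries the SERIES coupling `K''` on `i₀` (`tanh K''_{i₀} = tanh u · tanh w`).

Proof (steps (i)–(iii) of `helper_sp_subdivide`, without the inequality).  With `A` = old sites,
`B = {a', b', ℓ}`, `S = {a', b'}`, every bond of the subdivided structure lies in `A` or in `B`, so
`Σ'⁻¹ = [Σ'_AA⁻¹]⁰ + [Σ'_BB⁻¹]⁰ − [Σ'_SS⁻¹]⁰` (`helper_twoSep_markov`, `helper_twoSum_precision`);
for old `p ≠ q` with `{p, q} ≠ {a, b}` at most one of `p', q'` lies in `B` (resp. `S`), so only the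
first block contributes; and `Σ'_AA` re-indexed along `castSucc` is the second-moment matrix of the
old structure at the series coupling `½ log (cosh (u+w)/cosh (u−w))` (`spSub_marginal`,
`spSub_Ablock`), which equals `K'' i₀` by injectivity of `tanh` (`sei_tanh_series`).
-/

namespace Summit.CriticalPhenomena.Ising3DConformalLimit.Cruxes.InverseMFerromagnet.PartialCovarianceLadder

open Literature.Probability.LatticeModels Finset Matrix

noncomputable section

/-- **The series coupling through `tanh`.**
`tanh (½ log (cosh (u+w)/cosh (u−w))) = tanh u · tanh w`
(`e^{2K''} = cosh (u+w)/cosh (u−w)`, `(q−1)/(q+1)` with `cosh (u±w) = cosh u cosh w ± sinh u sinh w`).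
[folklore] -/
theorem sei_tanh_series (u w : ℝ) :
    Real.tanh (Real.log (Real.cosh (u + w) / Real.cosh (u - w)) / 2) = Real.tanh u * Real.tanh w := by
  have hq : 0 < Real.cosh (u + w) / Real.cosh (u - w) := div_pos (Real.cosh_pos _) (Real.cosh_pos _)
  have h2 : Real.exp (Real.log (Real.cosh (u + w) / Real.cosh (u - w)) / 2) ^ 2
      = Real.cosh (u + w) / Real.cosh (u - w) := by
    rw [sq, ← Real.exp_add, add_halves, Real.exp_log hq]
  rw [d6_tanh_eq_exp_sq, h2, Real.tanh_eq_sinh_div_cosh, Real.tanh_eq_sinh_div_cosh, Real.cosh_add,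
    Real.cosh_sub]
  have hu : Real.cosh u ≠ 0 := (Real.cosh_pos u).ne'
  have hw : Real.cosh w ≠ 0 := (Real.cosh_pos w).ne'
  have hm : Real.cosh u * Real.cosh w - Real.sinh u * Real.sinh w ≠ 0 := by
    rw [← Real.cosh_sub]; exact (Real.cosh_pos _).ne'
  have hp : Real.cosh u * Real.cosh w + Real.sinh u * Real.sinh w
      + (Real.cosh u * Real.cosh w - Real.sinh u * Real.sinh w) ≠ 0 := by
    rw [← Real.cosh_add, ← Real.cosh_sub]; positivity
  field_simp
  ring

/-- The series coupling is determined by its `tanh`: if `tanh k = tanh u · tanh w` then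
`k = ½ log (cosh (u+w)/cosh (u−w))` (`Real.tanh_injective`). [folklore] -/
theorem sei_series_eq {k u w : ℝ} (h : Real.tanh k = Real.tanh u * Real.tanh w) :
    k = Real.log (Real.cosh (u + w) / Real.cosh (u - w)) / 2 :=
  Real.tanh_injective (by rw [h, sei_tanh_series])

/-- **Θ2 · Subdividing a bond changes no precision entry away from it.**  In the setting of
`helper_sp_subdivide` (bond `i₀ = {a,b}` replaced by the path `a – last – b` with couplings
`K' i₀.castSucc`, `K' (Fin.last m)`), let `K''` be the old coupling vector with the SERIES coupling
on `i₀` (`tanh K''_{i₀} = tanh(K' i₀.castSucc) · tanh(K' last)`, other entries `K' i.castSucc`).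
Then for all old sites `p ≠ q` with `{p,q} ≠ {a,b}`: `(Σ'⁻¹)_{p' q'} = (Σ''⁻¹)_{pq}` (2-sum formula:
cross entries and the old block; the old-site marginal of the subdivided system IS the merged
system — `spSub_marginal`/`spSub_Ablock`). [folklore] -/
theorem helper_subdivide_entry_invariant :
    ∀ (n m : ℕ) (C : Fin m → Finset (Fin n)), (∀ i, (C i).card = 2) →
      ∀ (i₀ : Fin m) (a b : Fin n), a ≠ b → C i₀ = {a, b} →
      ∀ (C' : Fin (m + 1) → Finset (Fin (n + 1))),
        (∀ i : Fin m, i ≠ i₀ → C' i.castSucc = (C i).map Fin.castSuccEmb) →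
        C' i₀.castSucc = {a.castSucc, Fin.last n} →
        C' (Fin.last m) = {Fin.last n, b.castSucc} →
        ∀ (K' : Fin (m + 1) → ℝ), (∀ i, 0 ≤ K' i) →
        ∀ (K'' : Fin m → ℝ), (∀ i : Fin m, i ≠ i₀ → K'' i = K' i.castSucc) → 0 ≤ K'' i₀ →
          Real.tanh (K'' i₀) = Real.tanh (K' i₀.castSucc) * Real.tanh (K' (Fin.last m)) →
          ∀ p q : Fin n, p ≠ q → ({p, q} : Finset (Fin n)) ≠ {a, b} →
            (Matrix.of fun r s : Fin (n + 1) =>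
                gksExpect Finset.univ K' C' (fun ω => spinAt r ω * spinAt s ω))⁻¹ p.castSucc q.castSucc
              = (Matrix.of fun r s : Fin n =>
                  gksExpect Finset.univ K'' C (fun ω => spinAt r ω * spinAt s ω))⁻¹ p q := by
  intro n m C hC i₀ a b hab hCi₀ C' hC'1 hC'2 hC'3 K' hK' K'' hK''1 _ hK''t p q hpq hS
  -- the series coupling `K''` is the `½ log`-coupling of `spSub_marginal`
  obtain ⟨Kpp, hKpp⟩ : ∃ Kpp : ℝ, Kpp = Real.log (Real.cosh (K' i₀.castSucc + K' (Fin.last m))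
      / Real.cosh (K' i₀.castSucc - K' (Fin.last m))) / 2 := ⟨_, rfl⟩
  have hKv : K'' = fun i => if i = i₀ then Kpp else K' i.castSucc := by
    funext i
    by_cases hi : i = i₀
    · subst hi
      rw [if_pos rfl, hKpp]
      exact sei_series_eq hK''t
    · rw [if_neg hi]
      exact hK''1 i hi
  -- the subdivided structure and its 2-sum decomposition across `{a', b'}`
  have hC'card : ∀ j, (C' j).card = 2 := spSub_card C hC i₀ a b C' hC'1 hC'2 hC'3
  have hab' : a.castSucc ≠ b.castSucc := fun h => hab (Fin.castSucc_injective _ h)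
  set A : Finset (Fin (n + 1)) := Finset.univ.erase (Fin.last n) with hA
  have hsides : ∀ j, C' j ⊆ A ∨ C' j ⊆ insert a.castSucc (insert b.castSucc Aᶜ) :=
    spSub_sides C i₀ a b C' hC'1 hC'2 hC'3
  set B : Finset (Fin (n + 1)) := insert a.castSucc (insert b.castSucc Aᶜ) with hB
  have hmemA : ∀ z : Fin (n + 1), z ∈ A ↔ z ≠ Fin.last n := fun z => by simp [hA]
  have hmemB : ∀ z : Fin (n + 1), z ∈ B ↔ (z = a.castSucc ∨ z = b.castSucc ∨ z = Fin.last n) :=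
    fun z => by simp [hB, hA]
  have hmemS : ∀ z : Fin (n + 1), z ∈ ({a.castSucc, b.castSucc} : Finset (Fin (n + 1)))
      ↔ (z = a.castSucc ∨ z = b.castSucc) := fun z => by simp
  have haA : a.castSucc ∈ A := (hmemA _).2 (Fin.castSucc_ne_last a)
  have hbA : b.castSucc ∈ A := (hmemA _).2 (Fin.castSucc_ne_last b)
  set G : Matrix (Fin (n + 1)) (Fin (n + 1)) ℝ := Matrix.of fun p q : Fin (n + 1) =>
    gksExpect Finset.univ K' C' (fun ω => spinAt p ω * spinAt q ω) with hG
  have h2sum := helper_twoSum_precision (n + 1) (m + 1) K' C' hK' hC'card a.castSucc b.castSucc A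
    hab' haA hbA hsides G hG (helper_twoSep_markov (n + 1) (m + 1) K' C' hK' hC'card a.castSucc
      b.castSucc A hab' haA hbA hsides G hG)
  -- both sites old, not the separator pair: only the old block contributes
  have hx : p.castSucc ≠ Fin.last n := Fin.castSucc_ne_last p
  have hy : q.castSucc ≠ Fin.last n := Fin.castSucc_ne_last q
  have hpA : p.castSucc ∈ A := (hmemA _).2 hx
  have hqA : q.castSucc ∈ A := (hmemA _).2 hy
  have hpS : p.castSucc ∈ ({a.castSucc, b.castSucc} : Finset (Fin (n + 1))) → (p = a ∨ p = b) :=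
    fun h => ((hmemS _).1 h).imp (fun h => Fin.castSucc_injective _ h)
      (fun h => Fin.castSucc_injective _ h)
  have hqS : q.castSucc ∈ ({a.castSucc, b.castSucc} : Finset (Fin (n + 1))) → (q = a ∨ q = b) :=
    fun h => ((hmemS _).1 h).imp (fun h => Fin.castSucc_injective _ h)
      (fun h => Fin.castSucc_injective _ h)
  have hpB : p.castSucc ∈ B → (p = a ∨ p = b) := fun h => by
    rcases (hmemB _).1 h with h | h | h
    · exact Or.inl (Fin.castSucc_injective _ h)
    · exact Or.inr (Fin.castSucc_injective _ h)
    · exact absurd h hx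
  have hqB : q.castSucc ∈ B → (q = a ∨ q = b) := fun h => by
    rcases (hmemB _).1 h with h | h | h
    · exact Or.inl (Fin.castSucc_injective _ h)
    · exact Or.inr (Fin.castSucc_injective _ h)
    · exact absurd h hy
  have hnotS : ¬ (p.castSucc ∈ ({a.castSucc, b.castSucc} : Finset (Fin (n + 1))) ∧
      q.castSucc ∈ ({a.castSucc, b.castSucc} : Finset (Fin (n + 1)))) :=
    fun h => hS (spSub_pair_of_mem hpq (hpS h.1) (hqS h.2))
  have hnotB : ¬ (p.castSucc ∈ B ∧ q.castSucc ∈ B) :=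
    fun h => hS (spSub_pair_of_mem hpq (hpB h.1) (hqB h.2))
  rw [h2sum, dif_pos ⟨hpA, hqA⟩, dif_neg hnotB, dif_neg hnotS, add_zero, sub_zero, hKv]
  exact spSub_Ablock C i₀ a b hab hCi₀ C' hC'1 hC'2 hC'3 K' Kpp hKpp G hG p q hpA hqA

end

end Summit.CriticalPhenomena.Ising3DConformalLimit.Cruxes.InverseMFerromagnet.PartialCovarianceLadder
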